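import Mathlib
import Summits.ValiantsHypothesis.ValiantsHypothesis.Theorems.NewtonUnitEquationsTwoProductsFormalLogLinearisationDefs
import HarnessLib

/-!
# Crux `TwoProducts` (stmt-ValiantsHypothesis-5906), line `planar_cell`: the STAIRCASE FAMILY refuting SUB₂ — objects

Negative lane (val-lit-p3 g13, 2026-08-28; desk RULINGS #131/#133).  The registered stub `stub_planarSlotBound`
(= `PlanarCell.PlanarSlotBound`, SUB₂ of the line `Cruxes/TwoProducts/Lines/planar_cell.lean` @766c1b2fd55d) asserts a
`t`-FREE bound `(2m)^{c'}` on the number of tail coordinates occupying a fixed slot among cross representatives of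
pairwise distinct visible points of ONE weight-order cell.  It is FALSE already for `m = 2`; this file builds the
witness family and the companion file `PlanarSlotBoundFalse.lean` proves `not_planarSlotBound`.

THE FAMILY (parameter `K`).  Rows `a 0 = 1`, `a (n+1) = 2 a n + K`; columns `b 0 = a K + 1`,
`b (j+1) = b j + a (K-(j+1)) + j`; exponents `f_i = (a_i, 0)`, `g_j = (b_j, j)`, `p_{ij} = f_i + g_j = (a_i + b_j, j)`
(injective in `(i, j)`).  Tails: `u = (Σ_{i≤K} X^{f_i}, Σ_{j≤K} X^{g_j})`, `v = (u₀ + u₁ + h, 0)` with the STAIRCASE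
`h = Σ_{i+j<K} X^{p_{ij}}`, so that `(1+u₀)(1+u₁) − (1+v₀)(1+v₁) = u₀u₁ − h = W := Σ_{i+j≥K, i,j≤K} X^{p_{ij}}`
(`tailDiff_eq`).  The surviving grid points are minimised, for the weight `(2, 2k+1)`, uniquely at the CORNER
`(k, K-k)` (`cost_corner_lt`: the corner costs are `γ k + (i-k)²`).

Honest framing: a counterexample to ONE typed sub-statement of ONE line; it does NOT refute `PlanarCross` (SUB₁),
`PlanarCellBound`, the engine `stub_logSumEngine`, the crux `TwoProducts` (the family has polynomially many vertices)
or anything about `VP ≠ VNP` (NOT proved, not moved).  No named facts. [folklore]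
-/

noncomputable section

-- Sub = Summit single-conjunct layout: the duplicated namespace component is mandated by the tree.
set_option linter.dupNamespace false

open scoped BigOperators
open MvPolynomial
open Summit.ValiantsHypothesis.ValiantsHypothesis.Theorems.NewtonUnitEquations.TwoProducts.FormalLogLinearisation

namespace Summit.ValiantsHypothesis.ValiantsHypothesis.Theorems.TwoProducts.Negative.PlanarSlotBoundFalse


/-- Row abscissae: `a 0 = 1`, `a (n+1) = 2 a n + K`. [folklore] -/
def a (K : ℕ) : ℕ → ℕ
  | 0 => 1
  | n + 1 => 2 * a K n + K

/-- Column abscissae: `b 0 = a K + 1`, `b (j+1) = b j + a (K - (j+1)) + j`. [folklore] -/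
def b (K : ℕ) : ℕ → ℕ
  | 0 => a K K + 1
  | j + 1 => b K j + a K (K - (j + 1)) + j

/-- Unfolding `a 0`. [folklore] -/
theorem a_zero (K : ℕ) : a K 0 = 1 := rfl
/-- Unfolding `a (n+1)`. [folklore] -/
theorem a_succ (K n : ℕ) : a K (n + 1) = 2 * a K n + K := rfl
/-- Unfolding `b 0`. [folklore] -/
theorem b_zero (K : ℕ) : b K 0 = a K K + 1 := rfl
/-- Unfolding `b (j+1)`. [folklore] -/
theorem b_succ (K j : ℕ) : b K (j + 1) = b K j + a K (K - (j + 1)) + j := rfl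

/-- `a n ≥ 1`. [folklore] -/
theorem one_le_a (K n : ℕ) : 1 ≤ a K n := by
  induction n with
  | zero => simp [a_zero]
  | succ n ih => rw [a_succ]; omega

/-- `a` is strictly increasing at each step. [folklore] -/
theorem a_lt_succ (K n : ℕ) : a K n < a K (n + 1) := by
  rw [a_succ]; have := one_le_a K n; omega

/-- `a` is strictly increasing. [folklore] -/
theorem a_strictMono (K : ℕ) : StrictMono (a K) :=
  strictMono_nat_of_lt_succ fun n => a_lt_succ K n

/-- `a` is monotone. [folklore] -/
theorem a_le_a {K i j : ℕ} (h : i ≤ j) : a K i ≤ a K j := (a_strictMono K).monotone h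

/-- `b j ≥ 1`. [folklore] -/
theorem one_le_b (K j : ℕ) : 1 ≤ b K j := by
  induction j with
  | zero => rw [b_zero]; omega
  | succ j ih => rw [b_succ]; omega

/-- `b` is increasing at each step. [folklore] -/
theorem b_le_succ (K j : ℕ) : b K j ≤ b K (j + 1) := by rw [b_succ]; omega

/-- `b` is monotone. [folklore] -/
theorem b_mono (K : ℕ) : Monotone (b K) := monotone_nat_of_le_succ fun j => b_le_succ K j

/-- Every column abscissa exceeds `a K`. [folklore] -/
theorem aK_lt_b (K j : ℕ) : a K K < b K j := by
  have h0 : a K K < b K 0 := by rw [b_zero]; omega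
  exact lt_of_lt_of_le h0 (b_mono K (Nat.zero_le j))

/-- Every column abscissa exceeds every row abscissa `a i`, `i ≤ K`. [folklore] -/
theorem a_lt_b (K i j : ℕ) (hi : i ≤ K) : a K i < b K j :=
  lt_of_le_of_lt (a_le_a hi) (aK_lt_b K j)

/-- The cost of the grid point `(i, j)` for the scaled weight `(2, 2k+1)`: `2(a i + b j) + (2k+1) j`. [folklore] -/
def cost (K k i j : ℕ) : ℕ := 2 * (a K i + b K j) + (2 * k + 1) * j

/-- The cost is monotone in the column index. [folklore] -/
theorem cost_mono_j {K k i j j' : ℕ} (h : j ≤ j') : cost K k i j ≤ cost K k i j' := by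
  unfold cost
  have := b_mono K h
  have : (2 * k + 1) * j ≤ (2 * k + 1) * j' := Nat.mul_le_mul_left _ h
  omega

/-- The cost is strictly monotone in the column index. [folklore] -/
theorem cost_lt_of_lt_j {K k i j j' : ℕ} (h : j < j') : cost K k i j < cost K k i j' := by
  unfold cost
  have := b_mono K h.le
  have : (2 * k + 1) * j < (2 * k + 1) * j' := Nat.mul_lt_mul_of_pos_left h (by omega)
  omega

/-- Corner costs `γ i = cost i (K - i)` satisfy `γ (i+1) + 2k = γ i + 2i + 1` (`i < K`). [folklore] -/
theorem corner_step (K k i : ℕ) (hi : i < K) :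
    cost K k (i + 1) (K - (i + 1)) + 2 * k = cost K k i (K - i) + 2 * i + 1 := by
  obtain ⟨d, hd⟩ := Nat.exists_eq_add_of_lt hi
  have h1 : K - (i + 1) = d := by omega
  have h2 : K - i = d + 1 := by omega
  have h3 : K - (d + 1) = i := by omega
  unfold cost
  rw [h1, h2, b_succ, h3, a_succ]
  have hK : K = i + d + 1 := hd
  subst hK
  ring

/-- Closed form of the corner costs: `γ i + 2ki = γ 0 + i²` (`i ≤ K`). [folklore] -/
theorem corner_closed (K k i : ℕ) (hi : i ≤ K) :
    cost K k i (K - i) + 2 * k * i = cost K k 0 (K - 0) + i * i := by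
  induction i with
  | zero => simp
  | succ i ih =>
    have ih' := ih (by omega)
    have hs := corner_step K k i (by omega)
    nlinarith [hs, ih']

/-- `γ i = γ k + (i-k)²` (written with truncated subtraction both ways). [folklore] -/
theorem corner_min (K k i : ℕ) (hk : k ≤ K) (hi : i ≤ K) :
    cost K k k (K - k) + (i - k) * (i - k) + (k - i) * (k - i) = cost K k i (K - i) := by
  have h1 := corner_closed K k i hi
  have h2 := corner_closed K k k hk
  rcases le_total i k with h | h
  · have : i - k = 0 := by omega
    rw [this]
    obtain ⟨d, rfl⟩ := Nat.exists_eq_add_of_le h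
    have : i + d - i = d := by omega
    rw [this]
    nlinarith [h1, h2]
  · have : k - i = 0 := by omega
    rw [this]
    obtain ⟨d, rfl⟩ := Nat.exists_eq_add_of_le h
    have : k + d - k = d := by omega
    rw [this]
    nlinarith [h1, h2]

/-- The corner cost is uniquely minimised at `i = k`. [folklore] -/
theorem corner_lt (K k i : ℕ) (hk : k ≤ K) (hi : i ≤ K) (hne : i ≠ k) :
    cost K k k (K - k) < cost K k i (K - i) := by
  have h := corner_min K k i hk hi
  rcases Nat.lt_or_gt_of_ne hne with hlt | hlt
  · have h0 : 0 < k - i := by omega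
    have : 1 ≤ (k - i) * (k - i) := Nat.mul_pos h0 h0
    omega
  · have h0 : 0 < i - k := by omega
    have : 1 ≤ (i - k) * (i - k) := Nat.mul_pos h0 h0
    omega

/-- On the surviving grid points `{i, j ≤ K, K ≤ i + j}` the cost for the weight `(2, 2k+1)` is uniquely minimised at the corner `(k, K-k)`. [folklore] -/
theorem cost_corner_lt (K k i j : ℕ) (hk : k ≤ K) (hi : i ≤ K) (hij : K ≤ i + j)
    (hne : (i, j) ≠ (k, K - k)) : cost K k k (K - k) < cost K k i j := by
  have hj : K - i ≤ j := by omega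
  by_cases hik : i = k
  · subst hik
    have hj' : K - i < j := by
      rcases Nat.lt_or_ge (K - i) j with h | h
      · exact h
      · exfalso; apply hne; congr; omega
    exact cost_lt_of_lt_j hj'
  · exact lt_of_lt_of_le (corner_lt K k i hk hi hik) (cost_mono_j hj)

/-! ### Exponent vectors -/

/-- Row exponents `f_i = (a_i, 0)`. [folklore] -/
def fpt (K i : ℕ) : Expo := Finsupp.single 0 (a K i)

/-- Column exponents `g_j = (b_j, j)`. [folklore] -/
def gpt (K j : ℕ) : Expo := Finsupp.single 0 (b K j) + Finsupp.single 1 j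

/-- Grid points `p_{ij} = f_i + g_j`. [folklore] -/
def ppt (K : ℕ) (ij : ℕ × ℕ) : Expo := fpt K ij.1 + gpt K ij.2

/-- First coordinate of `f_i`. [folklore] -/
@[simp] theorem fpt_zero (K i : ℕ) : fpt K i 0 = a K i := by simp [fpt]
/-- Second coordinate of `f_i`. [folklore] -/
@[simp] theorem fpt_one (K i : ℕ) : fpt K i 1 = 0 := by simp [fpt]
/-- First coordinate of `g_j`. [folklore] -/
@[simp] theorem gpt_zero (K j : ℕ) : gpt K j 0 = b K j := by simp [gpt]
/-- Second coordinate of `g_j`. [folklore] -/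
@[simp] theorem gpt_one (K j : ℕ) : gpt K j 1 = j := by simp [gpt]
/-- First coordinate of `p_{ij}`. [folklore] -/
@[simp] theorem ppt_zero (K : ℕ) (ij : ℕ × ℕ) : ppt K ij 0 = a K ij.1 + b K ij.2 := by simp [ppt]
/-- Second coordinate of `p_{ij}`. [folklore] -/
@[simp] theorem ppt_one (K : ℕ) (ij : ℕ × ℕ) : ppt K ij 1 = ij.2 := by simp [ppt]

/-- `i ↦ f_i` is injective. [folklore] -/
theorem fpt_injective (K : ℕ) : Function.Injective (fpt K) := fun i i' h => by
  have := congrArg (fun e : Expo => e 0) h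
  simp only [fpt_zero] at this
  exact (a_strictMono K).injective this

/-- `j ↦ g_j` is injective. [folklore] -/
theorem gpt_injective (K : ℕ) : Function.Injective (gpt K) := fun j j' h => by
  have := congrArg (fun e : Expo => e 1) h
  simpa using this

/-- `(i,j) ↦ p_{ij} = (a_i + b_j, j)` is injective. [folklore] -/
theorem ppt_injective (K : ℕ) : Function.Injective (ppt K) := by
  rintro ⟨i, j⟩ ⟨i', j'⟩ h
  have h1 := congrArg (fun e : Expo => e 1) h
  have h0 := congrArg (fun e : Expo => e 0) h
  simp only [ppt_one] at h1
  subst h1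
  simp only [ppt_zero, Nat.add_right_cancel_iff] at h0
  have := (a_strictMono K).injective h0
  subst this
  rfl

/-! ### Index sets and the polynomials -/

/-- `{0, …, K}`. [folklore] -/
def idx (K : ℕ) : Finset ℕ := Finset.range (K + 1)

/-- The cancelled Young diagram `{(i,j) : i + j < K}`. [folklore] -/
def low (K : ℕ) : Finset (ℕ × ℕ) := (idx K ×ˢ idx K).filter fun ij => ij.1 + ij.2 < K

/-- The surviving grid points `{(i,j) : i, j ≤ K, K ≤ i + j}`. [folklore] -/
def high (K : ℕ) : Finset (ℕ × ℕ) := (idx K ×ˢ idx K).filter fun ij => K ≤ ij.1 + ij.2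

/-- Membership in `{0,…,K}`. [folklore] -/
theorem mem_idx {K i : ℕ} : i ∈ idx K ↔ i ≤ K := by simp [idx]

/-- Membership in the surviving set. [folklore] -/
theorem mem_high {K : ℕ} {ij : ℕ × ℕ} : ij ∈ high K ↔ ij.1 ≤ K ∧ ij.2 ≤ K ∧ K ≤ ij.1 + ij.2 := by
  simp [high, mem_idx, and_assoc]

/-- Membership in the cancelled staircase. [folklore] -/
theorem mem_low {K : ℕ} {ij : ℕ × ℕ} : ij ∈ low K ↔ ij.1 ≤ K ∧ ij.2 ≤ K ∧ ij.1 + ij.2 < K := by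
  simp [low, mem_idx, and_assoc]

/-- Sum of distinct monomials with coefficient `1`. [folklore] -/
def monoSum {α : Type*} (s : Finset α) (φ : α → Expo) : MvPolynomial (Fin 2) ℂ :=
  ∑ x ∈ s, monomial (φ x) 1

/-- Coefficients of a sum of distinct monomials with coefficient `1`. [folklore] -/
theorem coeff_monoSum {α : Type*} (s : Finset α) (φ : α → Expo) (hφ : Set.InjOn φ ↑s) (n : Expo) :
    coeff n (monoSum s φ) = if n ∈ s.image φ then 1 else 0 := by
  classical
  unfold monoSum
  rw [coeff_sum]
  simp only [coeff_monomial]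
  split_ifs with h
  · obtain ⟨x, hx, rfl⟩ := Finset.mem_image.1 h
    rw [Finset.sum_eq_single_of_mem x hx]
    · simp
    · intro y hy hne
      rw [if_neg]
      intro heq
      exact hne (hφ hy hx heq)
  · refine Finset.sum_eq_zero fun y hy => ?_
    rw [if_neg]
    intro heq
    exact h (Finset.mem_image.2 ⟨y, hy, heq⟩)

/-- Support of a sum of distinct monomials with coefficient `1`. [folklore] -/
theorem support_monoSum {α : Type*} (s : Finset α) (φ : α → Expo) (hφ : Set.InjOn φ ↑s) :
    (monoSum s φ).support = s.image φ := by
  classical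
  ext n
  rw [mem_support_iff, coeff_monoSum s φ hφ]
  split_ifs with h <;> simp [h]

/-- Membership in the support of a sum of distinct monomials. [folklore] -/
theorem mem_support_monoSum {α : Type*} {s : Finset α} {φ : α → Expo} (hφ : Set.InjOn φ ↑s) {n : Expo} :
    n ∈ (monoSum s φ).support ↔ ∃ x ∈ s, φ x = n := by
  rw [support_monoSum s φ hφ, Finset.mem_image]

/-- `u₀ = Σ_i X^{f_i}`. [folklore] -/
def u0 (K : ℕ) : MvPolynomial (Fin 2) ℂ := monoSum (idx K) (fpt K)
/-- `u₁ = Σ_j X^{g_j}`. [folklore] -/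
def u1 (K : ℕ) : MvPolynomial (Fin 2) ℂ := monoSum (idx K) (gpt K)
/-- `h = Σ_{i+j<K} X^{p_{ij}}` (the cancelled staircase). [folklore] -/
def hpoly (K : ℕ) : MvPolynomial (Fin 2) ℂ := monoSum (low K) (ppt K)
/-- `W = Σ_{i+j ≥ K} X^{p_{ij}}`. [folklore] -/
def Wpoly (K : ℕ) : MvPolynomial (Fin 2) ℂ := monoSum (high K) (ppt K)

/-- The tails `u = (u₀, u₁)`. [folklore] -/
def uu (K : ℕ) : Fin 2 → MvPolynomial (Fin 2) ℂ := ![u0 K, u1 K]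
/-- The tails `v = (u₀ + u₁ + h, 0)`. [folklore] -/
def vv (K : ℕ) : Fin 2 → MvPolynomial (Fin 2) ℂ := ![u0 K + u1 K + hpoly K, 0]

/-- `u₀ · u₁ = h + W`: the product of the two row/column tails splits into the cancelled staircase and the surviving part. [folklore] -/
theorem u0_mul_u1 (K : ℕ) : u0 K * u1 K = hpoly K + Wpoly K := by
  classical
  unfold u0 u1 hpoly Wpoly monoSum
  rw [Finset.sum_mul_sum, ← Finset.sum_product']
  simp only [monomial_mul, one_mul]
  unfold low high
  rw [← Finset.sum_filter_add_sum_filter_not (idx K ×ˢ idx K) (fun ij : ℕ × ℕ => ij.1 + ij.2 < K)]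
  congr 1
  · refine Finset.sum_congr ?_ fun _ _ => rfl
    ext ij
    simp only [Finset.mem_filter, not_lt]
  -- (the first summand already matches definitionally: `ppt K ij = fpt K ij.1 + gpt K ij.2`)

/-- `(1+u₀)(1+u₁) − (1+v₀)(1+v₁) = W` for `v = (u₀+u₁+h, 0)`: the staircase `h ⊂ supp v₀` cancels `{i+j<K}`. [folklore] -/
theorem tailDiff_eq (K : ℕ) : tailDiff (uu K) (vv K) = Wpoly K := by
  unfold tailDiff uu vv
  simp only [Fin.prod_univ_two, Matrix.cons_val_zero, Matrix.cons_val_one]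
  have := u0_mul_u1 K
  linear_combination this


/-! ### Supports -/

/-- Support of `u₀`. [folklore] -/
theorem support_u0 (K : ℕ) : (u0 K).support = (idx K).image (fpt K) :=
  support_monoSum _ _ (fpt_injective K).injOn

/-- Support of `u₁`. [folklore] -/
theorem support_u1 (K : ℕ) : (u1 K).support = (idx K).image (gpt K) :=
  support_monoSum _ _ (gpt_injective K).injOn

/-- Support of `W`. [folklore] -/
theorem support_W (K : ℕ) : (Wpoly K).support = (high K).image (ppt K) :=
  support_monoSum _ _ (ppt_injective K).injOn

/-- Support of `h`. [folklore] -/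
theorem support_h (K : ℕ) : (hpoly K).support = (low K).image (ppt K) :=
  support_monoSum _ _ (ppt_injective K).injOn

/-! ### Two-bump multi-indices -/

/-- A multi-index with two entries `1` and all others `0` has `∏ (μ_i + 1) = 4`. [folklore] -/
theorem prod_two_bumps {s : ℕ} (i₁ i₂ : Fin s) (h : i₁ ≠ i₂) :
    ∏ i, ((Pi.single i₁ 1 + Pi.single i₂ 1 : Fin s → ℕ) i + 1) = 4 := by
  classical
  rw [← Finset.mul_prod_erase _ _ (Finset.mem_univ i₁),
    ← Finset.mul_prod_erase _ _ (Finset.mem_erase.2 ⟨h.symm, Finset.mem_univ i₂⟩)]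
  rw [Finset.prod_eq_one]
  · simp [h, h.symm]
  · intro i hi
    simp only [Finset.mem_erase, Finset.mem_univ, and_true] at hi
    simp [hi.1, hi.2]

/-- `Σ_i δ_{i₁}(i) • E i = E i₁`. [folklore] -/
theorem sum_single_smul {s : ℕ} (E : Fin s → Expo) (i₁ : Fin s) :
    ∑ i, (Pi.single i₁ 1 : Fin s → ℕ) i • E i = E i₁ := by
  classical
  rw [Finset.sum_eq_single_of_mem i₁ (Finset.mem_univ _)]
  · simp
  · intro i _ hi
    simp [hi]

/-- `Σ_i (δ_{i₁} + δ_{i₂})(i) • E i = E i₁ + E i₂`. [folklore] -/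
theorem sum_two_bumps_smul {s : ℕ} (E : Fin s → Expo) (i₁ i₂ : Fin s) :
    ∑ i, (Pi.single i₁ 1 + Pi.single i₂ 1 : Fin s → ℕ) i • E i = E i₁ + E i₂ := by
  simp only [Pi.add_apply, add_smul, Finset.sum_add_distrib, sum_single_smul]



end Summit.ValiantsHypothesis.ValiantsHypothesis.Theorems.TwoProducts.Negative.PlanarSlotBoundFalse

end
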